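import Summits.BirchSwinnertonDyer.BirchSwinnertonDyer.Theorems.BiquadraticEisensteinDescentHeegnerTwistCouplingInSupplySymbolicMonskyEvenDesignNoSeven
import HarnessLib

set_option linter.dupNamespace false -- `Summit.BirchSwinnertonDyer.BirchSwinnertonDyer.Theorems.…` (summit = sub)
set_option autoImplicit false

/-!
# Crux `HeegnerTwistCouplingInSupply` (stmt-BirchSwinnertonDyer-21381) — EVEN bases with NO prime `≡ 7 (mod 8)`:
# at `δ = 1` the DIAGONAL section of the even pencil never obstructs either, so the even one-stage door is open iff the `V × 0` section is small

Route `BiquadraticEisensteinDescent` (cell `pub/bsd-wall`, width seat `bsd-wall-cm-bed-w3` g25; `--supports` 21381, helper). Sequel of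
`…SymbolicMonskyEvenDesignNoSeven` (w3 g25, the `0 × V` section). Setting of `…SymbolicMonskyEvenKernelParity` (p751399): for an even
root-number-`−1` base `E_{2·P₀⋯P_k}` (an odd number of `P_b ≡ 3 (mod 4)`, `hμ`) EVEN THEOREM A needs, at the design `δ = 1`, the three sections
of the even pencil `W_ev(1)` with `V × 0` (h1), `0 × V` (h2) and the diagonal (h3) to have dimension `≤ τ₀ = (dim 𝒦_ev + 1)/2`. On the family of
bases WITHOUT a prime `≡ 7 (mod 8)` (`[(-1/P_b) = −1] → [(2/P_b) = −1]`, classes `1, 3, 5 (mod 8)`), (h2) holds for every base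
(`two_mul_finrank_evenPencil_one_inf_ker_fst_le_of_noSeven`). This file adds (h3):
* `swap_mem_evenPencil_one_of_diag_of_noSeven` — MECHANISM: if `(u, u) ∈ W_ev(1)` with `⟨m,u⟩ = ⟨d,u⟩ = 0` then `(u, 0) ∈ W_ev(1)`. Indeed
  `(u,u) ∈ W_ev(1)` means `(u, u + γ·1) ∈ 𝒦_ev`; the difference of the two kernel equations gives `u|_D ≡ γ`, the column sums of the first
  (`Σ_i (Lu)_i = (1+μ)⟨m,u⟩`, quadratic reciprocity) give `γ = ⟨m,u⟩ + ⟨d,u⟩ = 0`; so `u|_D = 0`, and with `M ⊆ D` also `u|_M = 0`, `Lu = 0`,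
  `(0, u) ∈ 𝒦_ev`, `(u, 0) = T_1(0, u) ∈ W_ev(1)`.
* ★★ `two_mul_finrank_evenPencil_one_inf_diag_le_of_noSeven` — hence `2 · dim (W_ev(1) ∩ Δ) ≤ dim 𝒦_ev + 1 = 2τ₀` (the swap embeds the
  codimension-`≤ 2` part of the diagonal section into the `V × 0` section, missing `(1, 0)`; disjointness inside `W_ev(1)` and the kernel parity).
  So a base without a prime `≡ 7 (mod 8)` is never «horizontal»-exceptional (memo EVEN-EXCEPTIONAL-CLASS-w3g24: the horizontal class lives on
  bases with all primes `≡ 3 (mod 4)` and primes `≡ 7 (mod 8)` present).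
* ★★★ `exists_patternFree_even_design_one_of_noSeven_of_fst` — ONE-CONDITION DOOR: on this family `δ = 1` yields a pattern-free Heegner recipe
  with `τ₀ + 1` auxiliary primes as soon as `dim (W_ev(1) ∩ V×0) ≤ τ₀` (the only condition that can fail: the vertical exceptional bases
  `(3,5,5,5,5)` of `even_universality_fails`, p750799, lie in the family), and ★★★ `exists_recipe_cruxOn_even_one_of_noSeven_of_fst` — the same
  through the realisation door `RealisesK.cruxOn_even_of_BT_of_forall` (conclusion of `HeegnerTwistCouplingInSupply` at `(E_{2n}, P₀)`,
  modulo Burungale–Tian). Compare `…EvenDesignClassesThreeFive` (two classes `{3,5}`, design `δ = 0`, condition `a₁ ≤ τ₀`).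
HONEST FRAMING: RUNG-LEVEL corner layer (even congruent `j = 1728` families `E_{2n₀}`); `𝔽₂`-linear algebra attached to Monsky matrices
[cite: HeathBrown1994SelmerCongruentII, Appendix (Monsky), typescript p. 41 L20–L36]; instances need located primes (w4 layer) and the print input
[cite: BurungaleTian2026, Thm. 1.1]; the crux as stated (C⁺), its registered stubs and BSD are NOT touched; nothing is closed. THEOREMS ONLY.
-/

namespace Summit.BirchSwinnertonDyer.BirchSwinnertonDyer.Theorems.SymbolicMonsky

section NoSevenDiag

open Module Matrix Literature.NumberTheory.EllipticCurves Literature.NumberTheory.EllipticCurves.HeathBrown1994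
  Literature.NumberTheory.EllipticCurves.HeathBrown1994.Families
open Literature.NumberTheory.EllipticCurves.Rank1Residual

variable {k : ℕ} (base : SymbData (k + 1))

/-- Column sums of the Laplacian: `Σ_i Σ_j [(P_j/P_i) = −1](y_j + y_i) = (1 + μ)⟨m,y⟩` (quadratic reciprocity `bz_neg_swap`). [folklore] -/
private theorem sum_lap_eq_one_add_mu_mulΔ (y : Fin (k + 1) → ZMod 2) :
    (∑ i, ∑ j, bz (base.neg i j) * (y j + y i)) =
      (1 + ∑ b, bz (negNegOne (base.cls b))) * ∑ j, bz (negNegOne (base.cls j)) * y j := by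
  have h2 : ∀ x : ZMod 2, x + x = 0 := by decide
  have hsq : ∀ x : ZMod 2, x * x = x := by decide
  have e1 : (∑ i, ∑ j, bz (base.neg i j) * (y j + y i)) = ∑ i, ∑ j, (bz (base.neg j i) + bz (base.neg i j)) * y i := by
    have : (∑ i, ∑ j, bz (base.neg i j) * (y j + y i)) = (∑ i, ∑ j, bz (base.neg i j) * y j) + ∑ i, ∑ j, bz (base.neg i j) * y i := by
      rw [← Finset.sum_add_distrib]
      refine Finset.sum_congr rfl fun i _ => ?_
      rw [← Finset.sum_add_distrib]
      exact Finset.sum_congr rfl fun j _ => by ring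
    rw [this, Finset.sum_comm, ← Finset.sum_add_distrib]
    refine Finset.sum_congr rfl fun i _ => ?_
    rw [← Finset.sum_add_distrib]
    exact Finset.sum_congr rfl fun j _ => by ring
  have e2 : ∀ i, (∑ j, (bz (base.neg j i) + bz (base.neg i j)) * y i) =
      (∑ j, bz (negNegOne (base.cls i)) * bz (negNegOne (base.cls j)) * y i) + bz (negNegOne (base.cls i)) * y i := by
    intro i
    have hpt : ∀ j, (bz (base.neg j i) + bz (base.neg i j)) * y i =
        bz (negNegOne (base.cls i)) * bz (negNegOne (base.cls j)) * y i + (if j = i then bz (negNegOne (base.cls i)) * y i else 0) := by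
      intro j
      by_cases hji : j = i
      · subst hji
        rw [if_pos rfl]
        linear_combination (h2 (bz (base.neg j j))) * y j - (hsq (bz (negNegOne (base.cls j)))) * y j -
          h2 (bz (negNegOne (base.cls j)) * y j)
      · have hij : i ≠ j := fun h => hji h.symm
        rw [if_neg hji, base.bz_neg_swap hij, bz_and_mul]
        linear_combination (h2 (bz (base.neg i j))) * y i
    rw [Finset.sum_congr rfl fun j _ => hpt j, Finset.sum_add_distrib, Finset.sum_ite_eq' Finset.univ i]
    simp only [Finset.mem_univ, if_true]
  rw [e1, Finset.sum_congr rfl fun i _ => e2 i, Finset.sum_add_distrib, add_mul, one_mul, Finset.mul_sum]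
  have e3 : ∀ i, (∑ j, bz (negNegOne (base.cls i)) * bz (negNegOne (base.cls j)) * y i) =
      (∑ b, bz (negNegOne (base.cls b))) * (bz (negNegOne (base.cls i)) * y i) := by
    intro i
    rw [Finset.sum_mul]
    exact Finset.sum_congr rfl fun j _ => by ring
  rw [Finset.sum_congr rfl fun i _ => e3 i, add_comm]

/-- An even root-number-`−1` base (`Σ_b [P_b ≡ 3 (4)] = 1` in `𝔽₂`) has some prime `≡ 3 (mod 4)`. -/
private theorem exists_negNegOne_of_sum_eq_oneΔ (hμ : (∑ b, bz (negNegOne (base.cls b))) = 1) :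
    ∃ b₀, negNegOne (base.cls b₀) = true := by
  obtain ⟨b₀, -, hb₀⟩ := Finset.exists_ne_zero_of_sum_ne_zero
    (by rw [hμ]; exact one_ne_zero : (∑ b, bz (negNegOne (base.cls b))) ≠ 0)
  refine ⟨b₀, ?_⟩
  cases h : negNegOne (base.cls b₀) with
  | true => rfl
  | false => rw [h] at hb₀; exact absurd (by decide : bz false = 0) hb₀

/-- Cutting a subspace by one linear functional costs at most one dimension. -/
private theorem finrank_le_finrank_inf_ker_add_oneΔ {Z : Type*} [AddCommGroup Z] [Module (ZMod 2) Z] [FiniteDimensional (ZMod 2) Z]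
    (C : Submodule (ZMod 2) Z) (f : Z →ₗ[ZMod 2] ZMod 2) :
    finrank (ZMod 2) ↥C ≤ finrank (ZMod 2) ↥(C ⊓ LinearMap.ker f) + 1 := by
  have h1 := Submodule.finrank_sup_add_finrank_inf_eq C (LinearMap.ker f)
  have h2 := LinearMap.finrank_range_add_finrank_ker f
  have h3 : finrank (ZMod 2) ↥(LinearMap.range f) ≤ 1 := by
    have := Submodule.finrank_le (LinearMap.range f)
    rwa [Module.finrank_self] at this
  have h4 : finrank (ZMod 2) ↥(C ⊔ LinearMap.ker f) ≤ finrank (ZMod 2) Z := Submodule.finrank_le _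
  omega

/-- Elements of the even pencil at `δ = 1`: `(v + γ·1, u)` for an even kernel pair `(u, v)` and `γ ∈ 𝔽₂`. -/
private theorem mem_evenPencil_one_iffΔ (p : (Fin (k + 1) → ZMod 2) × (Fin (k + 1) → ZMod 2)) :
    p ∈ base.evenPencil (fun _ => 1) ↔
      ∃ (u v : Fin (k + 1) → ZMod 2) (γ : ZMod 2), (u, v) ∈ base.evenVirtualKernel ∧ p = (fun b => v b + γ, u) := by
  have h11 : (1 : ZMod 2) + 1 = 0 := by decide
  rw [mem_evenPencil_iff]
  constructor
  · rintro ⟨u, v, γ, hE1, hE2, rfl⟩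
    refine ⟨u, v, γ, (mem_evenVirtualKernel_iff base (u, v)).2 ⟨hE1, hE2⟩, Prod.ext ?_ ?_⟩
    · funext b; simp [h11]
    · funext b; simp [h11]
  · rintro ⟨u, v, γ, huv, rfl⟩
    obtain ⟨hE1, hE2⟩ := (mem_evenVirtualKernel_iff base (u, v)).1 huv
    refine ⟨u, v, γ, hE1, hE2, Prod.ext ?_ ?_⟩
    · funext b; simp [h11]
    · funext b; simp [h11]

/-- **MECHANISM (diagonal, no prime `≡ 7 (mod 8)`).** If `(u, u)` lies in the even pencil at `δ = 1` and `⟨m,u⟩ = ⟨d,u⟩ = 0`, then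
`(u, 0)` lies in it too. [cite: HeathBrown1994SelmerCongruentII, Appendix (Monsky), typescript p. 41 L20–L36] -/
theorem swap_mem_evenPencil_one_of_diag_of_noSeven
    (h7 : ∀ b, negNegOne (base.cls b) = true → negTwo (base.cls b) = true) (hμ : (∑ b, bz (negNegOne (base.cls b))) = 1)
    (p : (Fin (k + 1) → ZMod 2) × (Fin (k + 1) → ZMod 2))
    (hp : p ∈ base.evenPencil (fun _ => 1) ⊓ LinearMap.ker (LinearMap.fst (ZMod 2) (Fin (k + 1) → ZMod 2) (Fin (k + 1) → ZMod 2) +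
      LinearMap.snd (ZMod 2) (Fin (k + 1) → ZMod 2) (Fin (k + 1) → ZMod 2)))
    (hm : (∑ b, bz (negNegOne (base.cls b)) * p.2 b) = 0) (hd : (∑ b, bz (negTwo (base.cls b)) * p.2 b) = 0) :
    ((p.2, 0) : (Fin (k + 1) → ZMod 2) × (Fin (k + 1) → ZMod 2)) ∈
      base.evenPencil (fun _ => 1) ⊓ LinearMap.ker (LinearMap.snd (ZMod 2) (Fin (k + 1) → ZMod 2) (Fin (k + 1) → ZMod 2)) := by
  have h2 : ∀ x : ZMod 2, x + x = 0 := by decide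
  obtain ⟨hpW, hp0⟩ := Submodule.mem_inf.1 hp
  obtain ⟨u, v, γ, huv, rfl⟩ := (mem_evenPencil_one_iffΔ base p).1 hpW
  rw [LinearMap.mem_ker, LinearMap.add_apply, LinearMap.fst_apply, LinearMap.snd_apply] at hp0
  have hv : ∀ b, v b = u b + γ := fun b => by
    have := congrFun hp0 b
    simp only [Pi.add_apply, Pi.zero_apply] at this
    linear_combination this - h2 γ - h2 (u b)
  simp only at hm hd ⊢
  obtain ⟨hE1, hE2⟩ := (mem_evenVirtualKernel_iff base (u, v)).1 huv
  -- the two kernel equations of `(u, u + γ·1)` with `⟨m,u⟩ = 0`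
  have e1 : ∀ i, (∑ j, bz (base.neg i j) * (u j + u i)) + bz (negTwo (base.cls i)) * u i +
      bz (negNegOne (base.cls i)) * u i + bz (negNegOne (base.cls i)) * γ = 0 := fun i => by
    have e := hE1 i
    simp only [hm, hv, mul_zero, add_zero] at e
    linear_combination e
  have e2 : ∀ i, (∑ j, bz (base.neg i j) * (u j + u i)) + bz (negNegOne (base.cls i)) * u i + bz (negNegOne (base.cls i)) * γ +
      bz (negTwo (base.cls i)) * γ = 0 := fun i => by
    have e := hE2 i
    simp only [hm, mul_zero, add_zero] at e
    rw [funext hv, lap_add_const] at e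
    linear_combination e - h2 (bz (negTwo (base.cls i)) * u i)
  -- column sums: `γ = ⟨d,u⟩ + ⟨m,u⟩ = 0`
  have hγ : γ = 0 := by
    have hs : (∑ i, ((∑ j, bz (base.neg i j) * (u j + u i)) + bz (negTwo (base.cls i)) * u i +
        bz (negNegOne (base.cls i)) * u i + bz (negNegOne (base.cls i)) * γ)) = 0 := Finset.sum_eq_zero fun i _ => e1 i
    rw [Finset.sum_add_distrib, Finset.sum_add_distrib, Finset.sum_add_distrib, sum_lap_eq_one_add_mu_mulΔ base u, hm, hd,
      ← Finset.sum_mul, hμ] at hs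
    linear_combination hs
  -- difference of the equations: `u|_D = 0`; then `u|_M = 0` (no prime `≡ 7 (mod 8)`) and `Lu = 0`
  have hdu : ∀ i, bz (negTwo (base.cls i)) * u i = 0 := fun i => by
    have e : bz (negTwo (base.cls i)) * u i + bz (negTwo (base.cls i)) * γ = 0 := by
      linear_combination e1 i - e2 i + h2 (bz (negTwo (base.cls i)) * γ)
    rw [hγ, mul_zero, add_zero] at e
    exact e
  have hmu : ∀ i, bz (negNegOne (base.cls i)) * u i = 0 := fun i => by
    cases hi : negNegOne (base.cls i) with
    | false => exact zero_mul _
    | true =>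
      have := hdu i
      rw [h7 i hi] at this
      exact this
  have hlap : ∀ i, (∑ j, bz (base.neg i j) * (u j + u i)) = 0 := fun i => by
    have e := e2 i
    rw [hγ, hmu i, mul_zero, mul_zero, add_zero, add_zero, add_zero] at e
    exact e
  -- `(0, u) ∈ 𝒦_ev`, so `(u, 0) ∈ W_ev(1)`
  have h0u : ((0 : Fin (k + 1) → ZMod 2), u) ∈ base.evenVirtualKernel := by
    rw [mem_evenVirtualKernel_iff]
    refine ⟨fun i => ?_, fun i => ?_⟩
    · simp only [Pi.zero_apply, add_zero, mul_zero, Finset.sum_const_zero, zero_add]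
      exact hmu i
    · simp only [Pi.zero_apply, mul_zero, Finset.sum_const_zero, zero_add, add_zero]
      linear_combination hlap i + hmu i + hdu i
  refine Submodule.mem_inf.2 ⟨?_, by rw [LinearMap.mem_ker, LinearMap.snd_apply]⟩
  rw [mem_evenPencil_one_iffΔ]
  exact ⟨0, u, 0, h0u, Prod.ext (funext fun b => by simp) rfl⟩

/-- ★★ **No «horizontal» exceptional base without a prime `≡ 7 (mod 8)`, dimension form**: `2 · dim (W_ev(1) ∩ Δ) ≤ dim 𝒦_ev + 1`
(`= 2τ₀` by the kernel parity). The map `(u,u) ↦ (u,0)` embeds the codimension-`≤ 2` part `{⟨m,u⟩ = ⟨d,u⟩ = 0}` of the diagonal section into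
the `V × 0` section and misses its element `(1, 0)`; the two sections are disjoint in `W_ev(1)` (dimension `dim 𝒦_ev + 1`), and `dim 𝒦_ev` is
odd. [cite: HeathBrown1994SelmerCongruentII, Appendix (Monsky), typescript p. 41 L20–L36] -/
theorem two_mul_finrank_evenPencil_one_inf_diag_le_of_noSeven
    (h7 : ∀ b, negNegOne (base.cls b) = true → negTwo (base.cls b) = true) (hμ : (∑ b, bz (negNegOne (base.cls b))) = 1) :
    2 * finrank (ZMod 2) ↥(base.evenPencil (fun _ => 1) ⊓
        LinearMap.ker (LinearMap.fst (ZMod 2) (Fin (k + 1) → ZMod 2) (Fin (k + 1) → ZMod 2) +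
          LinearMap.snd (ZMod 2) (Fin (k + 1) → ZMod 2) (Fin (k + 1) → ZMod 2))) ≤
      finrank (ZMod 2) ↥base.evenVirtualKernel + 1 := by
  obtain ⟨b₀, hb₀⟩ := exists_negNegOne_of_sum_eq_oneΔ base hμ
  set W := base.evenPencil (fun _ => 1) with hWdef
  set H := W ⊓ LinearMap.ker (LinearMap.fst (ZMod 2) (Fin (k + 1) → ZMod 2) (Fin (k + 1) → ZMod 2) +
    LinearMap.snd (ZMod 2) (Fin (k + 1) → ZMod 2) (Fin (k + 1) → ZMod 2)) with hH
  set A := W ⊓ LinearMap.ker (LinearMap.snd (ZMod 2) (Fin (k + 1) → ZMod 2) (Fin (k + 1) → ZMod 2)) with hA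
  -- the two linear conditions `⟨m, p.2⟩ = 0`, `⟨d, p.2⟩ = 0`
  obtain ⟨φm, hφm⟩ := exists_dot_dual (k := k) (fun b => bz (negNegOne (base.cls b)))
  obtain ⟨φd, hφd⟩ := exists_dot_dual (k := k) (fun b => bz (negTwo (base.cls b)))
  set fm := φm.comp (LinearMap.snd (ZMod 2) (Fin (k + 1) → ZMod 2) (Fin (k + 1) → ZMod 2)) with hfm
  set fd := φd.comp (LinearMap.snd (ZMod 2) (Fin (k + 1) → ZMod 2) (Fin (k + 1) → ZMod 2)) with hfd
  set H₀ := (H ⊓ LinearMap.ker fm) ⊓ LinearMap.ker fd with hH₀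
  -- the map `p ↦ (p.2, 0)`
  set f := (LinearMap.inl (ZMod 2) (Fin (k + 1) → ZMod 2) (Fin (k + 1) → ZMod 2)).comp
    (LinearMap.snd (ZMod 2) (Fin (k + 1) → ZMod 2) (Fin (k + 1) → ZMod 2)) with hf
  have hf_apply : ∀ p : (Fin (k + 1) → ZMod 2) × (Fin (k + 1) → ZMod 2), f p = (p.2, 0) := fun p => by
    rw [hf, LinearMap.comp_apply, LinearMap.snd_apply, LinearMap.inl_apply]
  have hH₀A : H₀.map f ≤ A := by
    intro q hq
    obtain ⟨p, hp, rfl⟩ := Submodule.mem_map.1 hq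
    obtain ⟨hp1, hpd⟩ := Submodule.mem_inf.1 hp
    obtain ⟨hpH, hpm⟩ := Submodule.mem_inf.1 hp1
    have hm : (∑ b, bz (negNegOne (base.cls b)) * p.2 b) = 0 := by
      rw [LinearMap.mem_ker, hfm, LinearMap.comp_apply, LinearMap.snd_apply, hφm] at hpm
      exact hpm
    have hd : (∑ b, bz (negTwo (base.cls b)) * p.2 b) = 0 := by
      rw [LinearMap.mem_ker, hfd, LinearMap.comp_apply, LinearMap.snd_apply, hφd] at hpd
      exact hpd
    rw [hf_apply]
    exact swap_mem_evenPencil_one_of_diag_of_noSeven base h7 hμ p hpH hm hd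
  -- `f` is injective on `H₀` (a diagonal element with second component `0` vanishes)
  have hinj : Function.Injective (f.domRestrict H₀) := by
    rw [LinearMap.injective_domRestrict_iff, disjoint_iff, Submodule.eq_bot_iff]
    intro p hp
    obtain ⟨hp0, hpf⟩ := Submodule.mem_inf.1 hp
    obtain ⟨hp1, -⟩ := Submodule.mem_inf.1 hp0
    obtain ⟨hpH, -⟩ := Submodule.mem_inf.1 hp1
    have h12 : p.1 + p.2 = 0 := by
      have := (Submodule.mem_inf.1 hpH).2
      rwa [LinearMap.mem_ker, LinearMap.add_apply, LinearMap.fst_apply, LinearMap.snd_apply] at this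
    have hp2 : p.2 = 0 := by
      rw [LinearMap.mem_ker, hf_apply] at hpf
      exact congrArg Prod.fst hpf
    have hp1' : p.1 = 0 := by rw [hp2, add_zero] at h12; exact h12
    exact Prod.ext hp1' hp2
  have hfin : finrank (ZMod 2) ↥(H₀.map f) = finrank (ZMod 2) ↥H₀ := by
    rw [← LinearMap.range_domRestrict]
    exact LinearMap.finrank_range_of_inj hinj
  -- `(1, 0) ∈ A` but not in the image (`⟨m, 1⟩ = μ = 1`)
  set x₁ : (Fin (k + 1) → ZMod 2) × (Fin (k + 1) → ZMod 2) := (fun _ => 1, 0) with hx₁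
  have hx₁A : x₁ ∈ A := by
    refine Submodule.mem_inf.2 ⟨?_, by rw [LinearMap.mem_ker, LinearMap.snd_apply]⟩
    rw [mem_evenPencil_one_iffΔ]
    exact ⟨0, 0, 1, base.evenVirtualKernel.zero_mem, Prod.ext (funext fun b => by simp [hx₁]) rfl⟩
  have hx₁0 : x₁ ≠ 0 := by
    intro h
    have := congrFun (congrArg Prod.fst h) 0
    simp [hx₁] at this
  have hx₁not : x₁ ∉ H₀.map f := by
    intro hx
    obtain ⟨p, hp, hpx⟩ := Submodule.mem_map.1 hx
    obtain ⟨hp1, -⟩ := Submodule.mem_inf.1 hp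
    obtain ⟨-, hpm⟩ := Submodule.mem_inf.1 hp1
    rw [LinearMap.mem_ker, hfm, LinearMap.comp_apply, LinearMap.snd_apply, hφm] at hpm
    have hp2 : p.2 = fun _ => 1 := by
      have := congrArg Prod.fst hpx
      rw [hf_apply] at this
      simpa [hx₁] using this
    rw [hp2] at hpm
    simp only [mul_one] at hpm
    rw [hμ] at hpm
    exact one_ne_zero hpm
  -- dimension count
  have hdis : H₀.map f ⊓ Submodule.span (ZMod 2) {x₁} = ⊥ :=
    disjoint_iff.1 ((Submodule.disjoint_span_singleton' hx₁0).2 hx₁not)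
  have hsum₁ := Submodule.finrank_sup_add_finrank_inf_eq (H₀.map f) (Submodule.span (ZMod 2) {x₁})
  rw [hdis, finrank_bot, add_zero, finrank_span_singleton hx₁0, hfin] at hsum₁
  have hle₁ : finrank (ZMod 2) ↥(H₀.map f ⊔ Submodule.span (ZMod 2) {x₁}) ≤ finrank (ZMod 2) ↥A :=
    Submodule.finrank_mono (sup_le hH₀A ((Submodule.span_singleton_le_iff_mem _ _).2 hx₁A))
  have hcod₁ := finrank_le_finrank_inf_ker_add_oneΔ H fm
  have hcod₂ : finrank (ZMod 2) ↥(H ⊓ LinearMap.ker fm) ≤ finrank (ZMod 2) ↥H₀ + 1 :=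
    finrank_le_finrank_inf_ker_add_oneΔ (H ⊓ LinearMap.ker fm) fd
  have hHA : H ⊓ A = ⊥ := by
    rw [Submodule.eq_bot_iff]
    intro p hp
    obtain ⟨hpH, hpA⟩ := Submodule.mem_inf.1 hp
    have h12 : p.1 + p.2 = 0 := by
      have := (Submodule.mem_inf.1 hpH).2
      rwa [LinearMap.mem_ker, LinearMap.add_apply, LinearMap.fst_apply, LinearMap.snd_apply] at this
    have hp2 : p.2 = 0 := by
      have := (Submodule.mem_inf.1 hpA).2
      rwa [LinearMap.mem_ker, LinearMap.snd_apply] at this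
    have hp1 : p.1 = 0 := by rw [hp2, add_zero] at h12; exact h12
    exact Prod.ext hp1 hp2
  have hsup : H ⊔ A ≤ W := sup_le inf_le_left inf_le_left
  have hW : finrank (ZMod 2) ↥W = finrank (ZMod 2) ↥base.evenVirtualKernel + 1 :=
    finrank_evenPencil_eq base (fun _ => 1) (evenPencil_one_legit base b₀ hb₀)
  have hsum := Submodule.finrank_sup_add_finrank_inf_eq H A
  rw [hHA, finrank_bot, add_zero] at hsum
  have hmono := Submodule.finrank_mono hsup
  obtain ⟨r, hr⟩ := odd_finrank_evenVirtualKernel base hμ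
  omega

/-- ★★★ **ONE-CONDITION EVEN DOOR AT δ = 1 for bases with no prime `≡ 7 (mod 8)`.** For an even root-number-`−1` base `E_{2·P₀⋯P_k}` all of
whose primes `≡ 3 (mod 4)` are `≡ 3 (mod 8)`, put `τ₀ := (dim 𝒦_ev + 1)/2`. If the even pencil at `δ = 1` meets `V × 0` in dimension `≤ τ₀`,
a pattern-free Heegner recipe with `τ₀ + 1` auxiliary primes exists (cells `c₁ :: rest`, `|rest| = τ₀`, `heegnerK`, Monsky's even matrix
invertible for EVERY mutual pattern): the `0 × V` and diagonal conditions of EVEN THEOREM A are automatic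
(`two_mul_finrank_evenPencil_one_inf_ker_fst_le_of_noSeven`, `two_mul_finrank_evenPencil_one_inf_diag_le_of_noSeven`).
[cite: HeathBrown1994SelmerCongruentII, Appendix (Monsky), typescript p. 41 L20–L36] -/
theorem exists_patternFree_even_design_one_of_noSeven_of_fst
    (h7 : ∀ b, negNegOne (base.cls b) = true → negTwo (base.cls b) = true) (hμ : (∑ b, bz (negNegOne (base.cls b))) = 1)
    (h1 : finrank (ZMod 2) ↥(base.evenPencil (fun _ => 1) ⊓
      LinearMap.ker (LinearMap.snd (ZMod 2) (Fin (k + 1) → ZMod 2) (Fin (k + 1) → ZMod 2))) ≤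
        (finrank (ZMod 2) ↥base.evenVirtualKernel + 1) / 2) :
    ∃ (c₁ : AuxCell) (rest : List AuxCell), rest.length = (finrank (ZMod 2) ↥base.evenVirtualKernel + 1) / 2 ∧
      heegnerK base (c₁ :: rest) = true ∧ ∀ pat : ℕ → ℕ → Bool, (dataK base (c₁ :: rest) pat).monskyEvenS.det = 1 := by
  obtain ⟨r, hr⟩ := odd_finrank_evenVirtualKernel base hμ
  have h3 : finrank (ZMod 2) ↥(base.evenPencil (fun _ => 1) ⊓
      LinearMap.ker (LinearMap.fst (ZMod 2) (Fin (k + 1) → ZMod 2) (Fin (k + 1) → ZMod 2) +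
        LinearMap.snd (ZMod 2) (Fin (k + 1) → ZMod 2) (Fin (k + 1) → ZMod 2))) ≤
        (finrank (ZMod 2) ↥base.evenVirtualKernel + 1) / 2 := by
    have := two_mul_finrank_evenPencil_one_inf_diag_le_of_noSeven base h7 hμ
    omega
  exact exists_patternFree_even_design_one_of_noSeven base h7 hμ h1 h3

/-- ★★★ **The same through the realisation door**: for every even root-number-`−1` base with no prime `≡ 7 (mod 8)` whose even pencil at
`δ = 1` meets `V × 0` in dimension `≤ τ₀^{ev}`, one cell list `aux` (`τ₀^{ev} + 1` cells, `heegnerK`) such that any realising primes in the size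
window give the conclusion of `HeegnerTwistCouplingInSupply` at `(E_{2n}, P₀)`, modulo Burungale–Tian.
[cite: HeathBrown1994SelmerCongruentII, Appendix (Monsky), typescript p. 41 L20–L36] [cite: BurungaleTian2026, Thm. 1.1]
[cite: Oesterle1988Gauss, II §3 Proposition p. 57 (27)] -/
theorem exists_recipe_cruxOn_even_one_of_noSeven_of_fst (hBT : burungaleTian_analyticRank_eq_zero_of_selmerCorank_eq_zero_of_hasCM)
    (h7 : ∀ b, negNegOne (base.cls b) = true → negTwo (base.cls b) = true) (hμ : (∑ b, bz (negNegOne (base.cls b))) = 1)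
    (h1 : finrank (ZMod 2) ↥(base.evenPencil (fun _ => 1) ⊓
      LinearMap.ker (LinearMap.snd (ZMod 2) (Fin (k + 1) → ZMod 2) (Fin (k + 1) → ZMod 2))) ≤
        (finrank (ZMod 2) ↥base.evenVirtualKernel + 1) / 2) :
    ∃ aux : List AuxCell, aux.length = (finrank (ZMod 2) ↥base.evenVirtualKernel + 1) / 2 + 1 ∧ heegnerK base aux = true ∧
      ∀ (P : Fin (k + 1) → ℕ) (q : Fin aux.length → ℕ), RealisesK base aux P q →
        ∀ (n : ℕ) [(congruentNumberCurve (2 * n)).IsElliptic], (∏ b, P b) = n →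
          Real.sqrt ((∏ j, q j : ℕ) : ℝ) * Real.log ((∏ j, q j : ℕ) : ℝ) < Real.pi * P 0 →
          ∃ (K : Type) (_ : Field K) (_ : NumberField K),
            IsImaginaryQuadratic K ∧ 4 < (NumberField.discr K).natAbs ∧
            SatisfiesHeegnerHypothesis ((congruentNumberCurve (2 * n)).conductorNorm ℤ) K ∧
            ((congruentNumberCurve (2 * n)).quadraticTwist (NumberField.discr K : ℚ)).entireLFunction 1 ≠ 0 ∧
            ¬ P 0 ∣ NumberField.classNumber K := by
  obtain ⟨c₁, rest, hlen, hH, hdet⟩ := exists_patternFree_even_design_one_of_noSeven_of_fst base h7 hμ h1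
  refine ⟨c₁ :: rest, by simp [hlen], hH, ?_⟩
  intro P q hR n _ hn hsize
  exact hR.cruxOn_even_of_BT_of_forall hBT hH hdet hn hsize

end NoSevenDiag

end Summit.BirchSwinnertonDyer.BirchSwinnertonDyer.Theorems.SymbolicMonsky
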